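import Summits.SmoothPoincare4.SmoothPoincare4.Theorems.SullivanDualWitnessChargeCompletePackaging
import Summits.SmoothPoincare4.SmoothPoincare4.Theorems.SullivanDualWitnessChargeFlatChart
import Summits.SmoothPoincare4.SmoothPoincare4.Theorems.SullivanDualWitnessChargeStubBubbleConfinementHolomorphic
import Mathlib.Analysis.Complex.AbsMax

/-!
# Helper `helper_slabBound` of line `Sketch` (pencil-incompleteness) for crux `WitnessCharge`
(item stmt-SmoothPoincare4-7824; route `SullivanDual`, crux
`Summit.SmoothPoincare4.SmoothPoincare4.Theses.SullivanDual.WitnessCharge`; line `Sketch`,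
stub `helper_slabBound` — confinement, part 1: the slab bound)

**Slab bound.** In the complex flat coordinates `Ycoord p x = (z, w)` of the end at `p`
(`SullivanDualWitnessChargeDefs.lean`; `realify (Ycoord p x) = ι(e x − e p)`,
`SullivanDualWitnessChargeFlatChart.lean`), let `u : ℂ → Σ∖p` be continuous, let the preimage
`U = u⁻¹(B_{ε'})` of the punctured `ε'`-chart-ball (closed `ε'`-ball inside the chart target) be
open, `w ∘ u` complex differentiable on `U`, and `w(u ξ) → b` as `ξ → ∞` (along `cocompact ℂ`).
Then `‖w(u ξ)‖ ≤ max ε'⁻¹ ‖b‖` on `U`.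

Proof (maximum modulus principle in the form `Complex.norm_le_of_forall_mem_frontier_norm_le`;
no `J`-curve theory). If `‖w(u ξ₀)‖ > M = max ε'⁻¹ ‖b‖` at some `ξ₀ ∈ U`, pick `M < t < ‖w(u ξ₀)‖`
and let `V = {ξ ∈ U | t < ‖w(u ξ)‖}`. It is open, bounded (`‖w ∘ u‖ < t` off a compact set, as
`‖b‖ < t`), and `closure V ⊆ U`: on `V`, `‖e(u ξ) − e p‖ = ‖realify (Ycoord p (u ξ))‖⁻¹ < t⁻¹ < ε'`
(`‖w‖ ≤ ‖realify (z, w)‖`), the closed chart ball of radius `t⁻¹` is closed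
(`isClosed_closedChartBall`) and it lies inside the open `ε'`-chart-ball. So `w ∘ u` is
differentiable on `V`, continuous on `closure V`, and of norm `≤ t` on
`frontier V = closure V ∖ V ⊆ U ∖ V`; the maximum modulus principle on the bounded open `V` gives
`‖w(u ξ₀)‖ ≤ t`, a contradiction.
-/

noncomputable section

-- the registered namespace `Summit.SmoothPoincare4.SmoothPoincare4.…` repeats a component
set_option linter.dupNamespace false

open scoped Manifold ContDiff Topology
open Set Filter Literature.Geometry.Kaehler Literature.Geometry.Symplectic
  Literature.Topology.FourManifolds

namespace Summit.SmoothPoincare4.SmoothPoincare4.Theorems.WitnessCharge.PencilIncompleteness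

variable {S : HomotopySphere 4} {p : S.carrier} {ε' : ℝ}

/-- The transverse flat coordinate is bounded by the inverse chart distance:
`‖(Ycoord p x).2‖ ≤ ‖realify (Ycoord p x)‖ = ‖e x − e p‖⁻¹`. -/
theorem norm_Ycoord_snd_le (x : punctured p) :
    ‖(Ycoord p x).2‖ ≤ ‖extChartAt (𝓡 4) p x.1 - extChartAt (𝓡 4) p p‖⁻¹ := by
  have h := norm_le_norm_realify (Ycoord p x).1 (Ycoord p x).2
  rw [Prod.mk.eta, realify_Ycoord, norm_inversion] at h
  exact h

/-- On the punctured `ε'`-chart-ball: if `0 < t < ‖(Ycoord p x).2‖` then `‖e x − e p‖ < t⁻¹`. -/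
theorem norm_sub_lt_inv_of_lt_norm_Ycoord_snd {x : punctured p} (hx : InPuncturedChartBall p ε' x)
    {t : ℝ} (ht : 0 < t) (htx : t < ‖(Ycoord p x).2‖) :
    ‖extChartAt (𝓡 4) p x.1 - extChartAt (𝓡 4) p p‖ < t⁻¹ :=
  (lt_inv_comm₀ ht (norm_pos_iff.2 (sub_ne_zero_of_ball hx))).1
    (htx.trans_le (norm_Ycoord_snd_le x))

/-- **Slab bound (confinement, part 1).** For `0 < ε'` with the closed `ε'`-ball inside the chart
target, a continuous `u : ℂ → Σ∖p` whose preimage `U` of the punctured `ε'`-chart-ball is open,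
with transverse flat coordinate `w ∘ u = (Ycoord p ∘ u).2` complex differentiable on `U` and tending
to `b` at infinity, satisfies `‖w(u ξ)‖ ≤ max ε'⁻¹ ‖b‖` on `U` (maximum modulus principle on the
bounded open superlevel sets `{ξ ∈ U | t < ‖w(u ξ)‖}`, `t > max ε'⁻¹ ‖b‖`, whose closures stay in
`U` because `‖e(u ξ) − e p‖ < t⁻¹ < ε'` there). -/
theorem helper_slabBound :
    ∀ (S : HomotopySphere 4) (p : S.carrier) (ε' : ℝ) (u : ℂ → punctured p) (b : ℂ),
      0 < ε' →
      Metric.closedBall (extChartAt (𝓡 4) p p) ε' ⊆ (extChartAt (𝓡 4) p).target →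
      Continuous u →
      IsOpen {ξ : ℂ | InPuncturedChartBall p ε' (u ξ)} →
      DifferentiableOn ℂ (fun ξ : ℂ => (Ycoord p (u ξ)).2) {ξ : ℂ | InPuncturedChartBall p ε' (u ξ)} →
      Tendsto (fun ξ : ℂ => (Ycoord p (u ξ)).2) (cocompact ℂ) (𝓝 b) →
      ∀ ξ : ℂ, InPuncturedChartBall p ε' (u ξ) → ‖(Ycoord p (u ξ)).2‖ ≤ max ε'⁻¹ ‖b‖ := by
  intro S p ε' u b hε' hball hu hUopen hdiff hlim ξ₀ hξ₀
  refine le_of_not_gt fun hlt => ?_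
  -- a level `t` strictly between `M = max ε'⁻¹ ‖b‖` and `‖w (u ξ₀)‖`
  obtain ⟨t, hMt, htξ₀⟩ := exists_between hlt
  have hεt : ε'⁻¹ < t := (le_max_left _ _).trans_lt hMt
  have hbt : ‖b‖ < t := (le_max_right _ _).trans_lt hMt
  have ht : 0 < t := (inv_pos.2 hε').trans hεt
  have htε : t⁻¹ < ε' := (inv_lt_comm₀ hε' ht).1 hεt
  set e := extChartAt (𝓡 4) p with he
  set U : Set ℂ := {ξ | InPuncturedChartBall p ε' (u ξ)} with hU_def
  set w : ℂ → ℂ := fun ξ => (Ycoord p (u ξ)).2 with hw_def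
  -- the superlevel set `V = {ξ ∈ U | t < ‖w ξ‖}`: open, contains `ξ₀`
  set V : Set ℂ := U ∩ (fun ξ => ‖w ξ‖) ⁻¹' Ioi t with hV_def
  have hVU : V ⊆ U := inter_subset_left
  have hVopen : IsOpen V := hdiff.continuousOn.norm.isOpen_inter_preimage hUopen isOpen_Ioi
  have hξ₀V : ξ₀ ∈ V := ⟨hξ₀, htξ₀⟩
  -- `V` is bounded: `‖w‖ < t` off a compact set, by the limit at infinity and `‖b‖ < t`
  have hVbdd : Bornology.IsBounded V := by
    have hev : ∀ᶠ ξ in cocompact ℂ, w ξ ∈ Metric.ball (0 : ℂ) t :=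
      hlim.eventually (Metric.isOpen_ball.mem_nhds (mem_ball_zero_iff.2 hbt))
    obtain ⟨K, hK, hKsub⟩ := mem_cocompact'.1 hev
    refine hK.isBounded.subset fun ξ hξ => hKsub ?_
    rw [mem_compl_iff, mem_setOf_eq, mem_ball_zero_iff]
    exact fun h => lt_asymm h hξ.2
  -- `closure V ⊆ U`, through the closed chart ball of radius `t⁻¹ < ε'`
  set K : Set ℂ := {ξ | (u ξ).1 ∈ (chartAt (EuclideanSpace ℝ (Fin 4)) p).source ∧
    e (u ξ).1 ∈ Metric.closedBall (e p) t⁻¹} with hK_def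
  have hball' : Metric.closedBall (e p) t⁻¹ ⊆ e.target :=
    (Metric.closedBall_subset_closedBall htε.le).trans hball
  have hKclosed : IsClosed K :=
    (isClosed_closedChartBall p hball').preimage (continuous_subtype_val.comp hu)
  have hVK : V ⊆ K := fun ξ hξ =>
    ⟨hξ.1.1, by
      rw [Metric.mem_closedBall, dist_eq_norm]
      exact (norm_sub_lt_inv_of_lt_norm_Ycoord_snd hξ.1 ht hξ.2).le⟩
  have hKU : K ⊆ U := fun ξ hξ => ⟨hξ.1, Metric.closedBall_subset_ball htε hξ.2⟩
  have hclVU : closure V ⊆ U := (closure_minimal hVK hKclosed).trans hKU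
  -- the maximum modulus principle on the bounded open `V`
  have hdc : DiffContOnCl ℂ w V := ⟨hdiff.mono hVU, hdiff.continuousOn.mono hclVU⟩
  have hC : ∀ z ∈ frontier V, ‖w z‖ ≤ t := by
    intro z hz
    rw [hVopen.frontier_eq] at hz
    exact le_of_not_gt fun h => hz.2 ⟨hclVU hz.1, h⟩
  have hle : ‖w ξ₀‖ ≤ t :=
    Complex.norm_le_of_forall_mem_frontier_norm_le hVbdd hdc hC (subset_closure hξ₀V)
  exact lt_irrefl _ (htξ₀.trans_le hle)

end Summit.SmoothPoincare4.SmoothPoincare4.Theorems.WitnessCharge.PencilIncompleteness
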